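import Summits.ABC.StewartYu.ArchG3Levels
import Summits.ABC.StewartYu.GenThreeEndBridgeTwo
import Summits.ABC.StewartYu.PadicG3TwoFrameAssembly
import HarnessLib

/-!
# Cell abc-stewartyu, rung A1.L (crux r2 `ArchCoreRat`), WP-L.A: the OUTPUT of the archimedean frame — the last level's Δ-invariant gives
# `FrameOutputTwo` (the place-free input of the END / zero estimate)

`Summits/ABC/StewartYu/ArchG3Output.lean` — cell `abc-stewartyu` (HOME `run/shared/lean/pub/abc-stewartyu/`; TRANCHE PLAN v1.2 §4′ P-A5/P-A7
junction; seat lp-1 g8).  Theorems on `ArchG3Setup.ArchLvInv`; no definition, no named fact.  Archimedean twin of `G3Setup.LvInvI.frameOutput`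
(`PadicG3Output`, seat p2-g4): the vanishing IN Δ-FORM of the last level, `archφ R v B (pvΔ pv c e μ) (a, 0) x = 0` for `|x| ≤ N`,
`a + |μ| < T`, gives — by the change of basis `archφ_pvΔ_eq_zero_of_invariant` at `μ = 0` (print (4.21) ⇒ (4.6)) — the MONOMIAL identities
`archφ R v B pv (t, ν) x = 0` for `t + |ν| < T`, i.e. after clearing `b_{j₀}^{|ν|}` (`zγpow = ∏ 𝔛ₖ^{νₖ}·b_{j₀}^{−|ν|}`) exactly the scalar
identities (5.4) that `GenThreeEndBridgeTwo.frameOutputTwo_of_hasseIdentities` turns into `GenThreeFrameSpecTwo.FrameOutputTwo` — the SAME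
place-free output predicate as the `p`-adic frames, so the END (zero estimate `Nesterenko2003_prop51_holds`, obstruction subgroup, exits) is shared.
Over `ℝ` there is no sign twist, so no passage to even points and no `Y₀ ↦ 2Y₀` (contrast `LvInvI.frameOutput`): the box of the output is `L` itself.

* `ArchLvInv.archφ_monomial_eq_zero` — Δ-invariant ⇒ monomial identities;
* `ArchLvInv.frameOutputTwo_of_fibre` — generic `Y₀`-weights `R` of degree `≤ D₀` with one non-zero exponent fibre `Σ_{vᵢ = κ₀} pᵢ Rᵢ ≠ 0`;
* `ArchLvInv.frameOutputTwo` — the last-level instance `Rᵢ = feldR i.1 H` (Fel'dman basis, degree-triangular ⇒ the fibre of any non-zero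
  coefficient is non-zero, `FeldmanBasis.exists_fibre_ne_zero`), exponents injective in `λ`: `(n+1)X′ ≤ N`, `(n+1)S₀ < T` ⇒
  `FrameOutputTwo n α b j₀ D₀ S₀ X′ L`.

WHAT THIS IS NOT: the END itself (record obligations `RecordTwo`-type, exits to `StepArch`, P-A7/P-A9) nor the schedule that reaches the last level.

## References
* Yu. V. Nesterenko, LNM 1819 (2003) — §4 (4.6)–(4.7) p. 80–81, §4.2 (4.21) p. 85–86, §5.1 (5.1)–(5.4) p. 95–97. [Nesterenko2003]
* K. Yu, Acta Math. 211 (2013) — §6 (the `p`-adic model). [Yu2013]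
-/

noncomputable section

open Finset Polynomial
open Literature.NumberTheory.Transcendental
open Literature.NumberTheory.Transcendental.CW77.Setup (Tau tauNorm)
open Summit.ABC.StewartYu.FeldmanBasis (feldR exists_fibre_ne_zero natDegree_feldR_le)
open scoped Nat

namespace Summit.ABC.StewartYu

namespace ArchG3Setup

namespace ArchLvInv

variable {S : ArchG3Setup} {ι : Type*} {R : ι → ℚ[X]} {B : Finset ι} {v : ι → Fin S.n → ℤ} {pv : ι → ℤ} {lo : Fin S.n → ℤ}
  {L : Fin S.n → ℕ} {P : ℤ} {w γ : ℝ} {c : ℤ} {e : Fin S.n → ℤ} {N T : ℕ}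

/-- **Monomial identities from the Δ-invariant**: `archφ R v B pv (t, ν) x = 0` at the nodes for `t + |ν| < T` (change of basis at `μ = 0`).
[cite: Nesterenko2003, §4.2 (4.21) and §4 (4.6), p. 80–86] -/
theorem archφ_monomial_eq_zero {Xs : Set ℤ} (h : S.ArchLvInv R B v pv lo L P w γ c e Xs T) {x : ℤ} (hx : x ∈ Xs) (τ : Tau S.n)
    (hτ : tauNorm τ < T) : S.archφ R v B pv τ x = 0 := by
  have h1 := S.archφ_pvΔ_eq_zero_of_invariant R v B pv h.c_ne e x T (fun a' μ' h' => h.vanish x hx a' μ' h') 0 τ (by simpa using hτ)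
  simpa using h1

/-- **The frame output from the last level, generic `Y₀`-weights**: an `ArchLvInv` at the nodes `|x| ≤ N` of order `T` with
`deg Rᵢ ≤ D₀`, ONE non-zero exponent fibre `Σ_{vᵢ = κ₀} pᵢ Rᵢ ≠ 0`, `(n+1)X′ ≤ N` and `(n+1)S₀ < T` gives
`FrameOutputTwo n α b j₀ D₀ S₀ X′ L`. [cite: Nesterenko2003, §5.1 (5.1)–(5.4), p. 95–97] -/
theorem frameOutputTwo_of_fibre (h : S.ArchLvInv R B v pv lo L P w γ c e {x : ℤ | |x| ≤ (N : ℤ)} T)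
    {D₀ : ℕ} (hdeg : ∀ i ∈ B, (R i).natDegree ≤ D₀)
    (hne : ∃ κ₀ : Fin S.n → ℤ, ∑ i ∈ B.filter (fun i => v i = κ₀), (pv i : ℚ) • R i ≠ 0)
    {X' S₀ : ℕ} (hX : (S.n + 1) * X' ≤ N) (hS : (S.n + 1) * S₀ < T) :
    GenThreeFrameSpecTwo.FrameOutputTwo S.n S.α S.b S.j₀ D₀ S₀ X' L := by
  classical
  refine GenThreeEndBridgeTwo.frameOutputTwo_of_hasseIdentities B R v (fun i => (pv i : ℚ)) S.α S.b S.j₀ D₀ S₀ X' L hdeg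
    h.abs_le hne ?_
  intro x hx t ν _hν hsum
  have hxN : |x| ≤ (N : ℤ) := le_trans hx (by exact_mod_cast hX)
  -- the monomial identity at `(t, ν)`
  have hmono : S.archφ R v B pv ((t, ν) : Tau S.n) x = 0 :=
    h.archφ_monomial_eq_zero (Xs := {x : ℤ | |x| ≤ (N : ℤ)}) hxN (t, ν) (by unfold tauNorm; simp only; omega)
  -- clear `b_{j₀}^{|ν|}`: the bridge sum is `b_{j₀}^{|ν|} · archφ`
  have hb : (S.b S.j₀ : ℚ) ≠ 0 := S.bj₀_ne_rat
  have hbb : (S.b S.j₀ : ℚ) ^ (∑ k, ν k) * ((S.b S.j₀ : ℚ)⁻¹) ^ (∑ k, ν k) = 1 := by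
    rw [← mul_pow, mul_inv_cancel₀ hb, one_pow]
  have hterm : ∀ i ∈ B, (pv i : ℚ) * (hasseDeriv t (R i)).eval (x : ℚ) *
      (∏ k, ((S.b S.j₀ * v i k - S.b k * v i S.j₀ : ℤ) : ℚ) ^ ν k) * ∏ j, S.α j ^ (x * v i j) =
      (S.b S.j₀ : ℚ) ^ (∑ k, ν k) *
        ((pv i : ℚ) * (hasseDeriv t (R i)).eval (x : ℚ) * S.zγpow v i ν * ∏ j, S.α j ^ (v i j * x)) := by
    intro i _
    rw [S.zγpow_eq_prod_mul_inv_pow]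
    have hX : ∀ k, ((S.b S.j₀ * v i k - S.b k * v i S.j₀ : ℤ) : ℚ) = (S.𝔛 (v i) k : ℚ) := fun k => by
      unfold ArchG3Setup.𝔛; rfl
    have hexp : ∀ j, x * v i j = v i j * x := fun j => mul_comm _ _
    simp_rw [hX, hexp]
    calc (pv i : ℚ) * (hasseDeriv t (R i)).eval (x : ℚ) * (∏ k, (S.𝔛 (v i) k : ℚ) ^ ν k) * ∏ j, S.α j ^ (v i j * x)
        = ((S.b S.j₀ : ℚ) ^ (∑ k, ν k) * ((S.b S.j₀ : ℚ)⁻¹) ^ (∑ k, ν k)) *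
            ((pv i : ℚ) * (hasseDeriv t (R i)).eval (x : ℚ) * (∏ k, (S.𝔛 (v i) k : ℚ) ^ ν k) * ∏ j, S.α j ^ (v i j * x)) := by
          rw [hbb, one_mul]
      _ = _ := by ring
  rw [sum_congr rfl hterm, ← mul_sum]
  unfold archφ at hmono
  simp only at hmono
  rw [hmono, mul_zero]

/-- **The frame output from the last level** (Fel'dman basis `Rᵢ = Δ(Y₀; i.1, H)` with `i.1 ≤ D₀` on `B`, exponents injective in `λ = i.2`):
`(n+1)X′ ≤ N`, `(n+1)S₀ < T` ⇒ `FrameOutputTwo n α b j₀ D₀ S₀ X′ L`.  Twin of `G3Setup.LvInvI.frameOutput` (no even points, box `L`).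
[cite: Nesterenko2003, §5.1 (5.1)–(5.4), p. 95–97] [cite: Yu2013, §6] -/
theorem frameOutputTwo {K : Type*} [DecidableEq K] {B : Finset (ℕ × K)} {v : ℕ × K → Fin S.n → ℤ} {pv : ℕ × K → ℤ} {H : ℕ}
    (h : S.ArchLvInv (fun i => feldR i.1 H) B v pv lo L P w γ c e {x : ℤ | |x| ≤ (N : ℤ)} T)
    {D₀ : ℕ} (hdeg : ∀ i ∈ B, i.1 ≤ D₀) (hv : ∀ i ∈ B, ∀ i' ∈ B, v i = v i' ↔ i.2 = i'.2)
    {X' S₀ : ℕ} (hX : (S.n + 1) * X' ≤ N) (hS : (S.n + 1) * S₀ < T) :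
    GenThreeFrameSpecTwo.FrameOutputTwo S.n S.α S.b S.j₀ D₀ S₀ X' L := by
  classical
  obtain ⟨i₀, hi₀B, hi₀⟩ := h.nonzero
  refine h.frameOutputTwo_of_fibre (fun i hi => (natDegree_feldR_le _ _).trans (hdeg i hi)) ?_ hX hS
  -- a non-zero exponent fibre (degree-triangular basis)
  obtain ⟨κ₀, hne⟩ := exists_fibre_ne_zero H B pv hi₀B hi₀
  have hnonempty : (B.filter (fun i => i.2 = κ₀)).Nonempty := by
    by_contra h0
    rw [Finset.not_nonempty_iff_eq_empty] at h0
    rw [h0, sum_empty] at hne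
    exact hne rfl
  obtain ⟨i₁, hi₁⟩ := hnonempty
  have hi₁B : i₁ ∈ B := (mem_filter.mp hi₁).1
  have hi₁κ : i₁.2 = κ₀ := (mem_filter.mp hi₁).2
  refine ⟨v i₁, ?_⟩
  have hfib : B.filter (fun i => v i = v i₁) = B.filter (fun i => i.2 = κ₀) := by
    refine filter_congr fun i hi => ?_
    rw [← hi₁κ]
    exact hv i hi i₁ hi₁B
  rw [hfib]
  exact hne

end ArchLvInv

end ArchG3Setup

end Summit.ABC.StewartYu

end
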